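import Summits.AtomisticToContinuum.Crystallization.Theorems.FrustratedLawDichotomyStrainedPatchHomValueT2Kit

/-!
# (I1) part A — soundness of the TIGHT COEFFICIENT HULLS of the G5′ value leaf (`…HomValueT2Kit` §1b): monotonicity of the Lennard-Jones closed forms
# `F(u) = 14u⁸ − 8u⁵ ∋ α_LJ` and `G(u) = u⁴ − u⁷ ∋ β_LJ` (`u = q⁻¹ = ρ⁻²`), the endpoint hulls `alphaLJHull / betaLJHull`, the clipped `w`-interval `wOf`,
# (the dispatcher `mem_coeffT` follows in part A2)
# (27623 `(H) HomFloor`, hcp half; decomp-a2c hand-1 g41; first instalment of the soundness theorem `valueLeafT2_sound`, FINDING-hand-1-g41 §6 (R3)).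

`F′(u) = 8u⁴(14u³ − 5)` and `G′(u) = u³(4 − 7u³)`: `F` is antitone while `14u³ ≤ 5` and monotone from there on (so `α_LJ(q) = F(q⁻¹)` is DEcreasing for
`q ≤ 7/5` and INcreasing for `q ≥ 71/50`, and on any interval its maximum sits at an end point); `G` is monotone while `7u³ ≤ 4` and antitone beyond (so
`β_LJ` is increasing for `q ≤ 119/100`, decreasing for `q ≥ 61/50`, minimum always at an end point).  No tables, no `decide`; 0 sorry; standard axioms;
no instances / notation / `#eval`.  `--supports stmt-AtomisticToContinuum-27623`.
-/

noncomputable section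

namespace Summit.AtomisticToContinuum.Crystallization.Theorems.FrustratedLawDichotomyStrainedPatchHomValueT2Kit

open Literature.Analysis.ValidatedNumerics.Numerics
open Summit.AtomisticToContinuum.Crystallization.Theorems.FrustratedLawDichotomySchurCut (effPot w₄₅ ω₄)
open Summit.AtomisticToContinuum.Crystallization.Theorems.FrustratedLawDichotomyStrainedPatchHomForceKit (phiFI mem_phiFI)
open Summit.AtomisticToContinuum.Crystallization.Theorems.FrustratedLawDichotomyStrainedPatchHomCurvCoeff
  (coeffFI2 alphaLJFI mem_alphaLJFI wFI mem_wFI rhoFI mem_rhoFI bumpS54FI mem_bumpS54FI mem_coeffFI2)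
open Summit.AtomisticToContinuum.Crystallization.Theorems.FrustratedLawDichotomyStrainedPatchHomCurvCoeff3 (bumpTFI mem_bumpTFI k75 mem_k75 inv_sq_pow)
open Summit.AtomisticToContinuum.Crystallization.Theorems.FrustratedLawDichotomyStrainedPatchHomCurvRegime3
  (alphaLJ betaLJ alphaB betaB bumpT bumpS alphaTrue_eq_lj betaTrue_eq_lj alphaTrue_eq_bump betaTrue_eq_bump)
open Summit.AtomisticToContinuum.Crystallization.Theorems.FrustratedLawDichotomyStrainedPatchTaylorLeaves (junctions)

/-! ## §1. The two closed forms in `u = q⁻¹` and their monotonicity -/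

/-- `F(u) = 14u⁸ − 8u⁵` (`= α_LJ` at `u = ρ⁻²`). -/
def FLJ (u : ℝ) : ℝ := 14 * u ^ 8 - 8 * u ^ 5

/-- `G(u) = u⁴ − u⁷` (`= β_LJ` at `u = ρ⁻²`). -/
def GLJ (u : ℝ) : ℝ := u ^ 4 - u ^ 7

/-- `F′(u) = 112u⁷ − 40u⁴`. [folklore] -/
theorem hasDerivAt_FLJ (u : ℝ) : HasDerivAt FLJ (112 * u ^ 7 - 40 * u ^ 4) u := by
  have h := ((hasDerivAt_pow 8 u).const_mul 14).sub ((hasDerivAt_pow 5 u).const_mul 8)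
  refine (h.congr_deriv ?_).congr_of_eventuallyEq ?_
  · push_cast; ring
  · exact Filter.Eventually.of_forall fun x => rfl

/-- `G′(u) = 4u³ − 7u⁶`. [folklore] -/
theorem hasDerivAt_GLJ (u : ℝ) : HasDerivAt GLJ (4 * u ^ 3 - 7 * u ^ 6) u := by
  have h := (hasDerivAt_pow 4 u).sub (hasDerivAt_pow 7 u)
  refine (h.congr_deriv ?_).congr_of_eventuallyEq ?_
  · push_cast; ring
  · exact Filter.Eventually.of_forall fun x => rfl

/-- `F` is monotone on `[a, b]` once `14a³ ≥ 5` (`a ≥ 0`). [folklore] -/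
theorem FLJ_monotoneOn {a b : ℝ} (ha : 0 ≤ a) (h : 5 ≤ 14 * a ^ 3) : MonotoneOn FLJ (Set.Icc a b) := by
  refine monotoneOn_of_deriv_nonneg (convex_Icc a b) (fun x _ => (hasDerivAt_FLJ x).continuousAt.continuousWithinAt)
    (fun x _ => (hasDerivAt_FLJ x).differentiableAt.differentiableWithinAt) ?_
  intro x hx
  rw [interior_Icc] at hx
  rw [(hasDerivAt_FLJ x).deriv]
  have hx0 : a ≤ x := hx.1.le
  have hxpos : 0 ≤ x := ha.trans hx0
  have h3 : a ^ 3 ≤ x ^ 3 := pow_le_pow_left₀ ha hx0 3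
  have h14 : 5 ≤ 14 * x ^ 3 := by linarith
  have e : 112 * x ^ 7 - 40 * x ^ 4 = 8 * x ^ 4 * (14 * x ^ 3 - 5) := by ring
  rw [e]
  have : 0 ≤ x ^ 4 := by positivity
  have : 0 ≤ 14 * x ^ 3 - 5 := by linarith
  positivity

/-- `F` is antitone on `[a, b]` once `14b³ ≤ 5` (`a ≥ 0`). [folklore] -/
theorem FLJ_antitoneOn {a b : ℝ} (ha : 0 ≤ a) (h : 14 * b ^ 3 ≤ 5) : AntitoneOn FLJ (Set.Icc a b) := by
  refine antitoneOn_of_deriv_nonpos (convex_Icc a b) (fun x _ => (hasDerivAt_FLJ x).continuousAt.continuousWithinAt)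
    (fun x _ => (hasDerivAt_FLJ x).differentiableAt.differentiableWithinAt) ?_
  intro x hx
  rw [interior_Icc] at hx
  rw [(hasDerivAt_FLJ x).deriv]
  have hxpos : 0 ≤ x := ha.trans hx.1.le
  have hxb : x ≤ b := hx.2.le
  have h3 : x ^ 3 ≤ b ^ 3 := pow_le_pow_left₀ hxpos hxb 3
  have e : 112 * x ^ 7 - 40 * x ^ 4 = -(8 * x ^ 4 * (5 - 14 * x ^ 3)) := by ring
  rw [e, neg_nonpos]
  have : 0 ≤ x ^ 4 := by positivity
  have : 0 ≤ 5 - 14 * x ^ 3 := by linarith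
  positivity

/-- `G` is monotone on `[a, b]` once `7b³ ≤ 4` (`a ≥ 0`). [folklore] -/
theorem GLJ_monotoneOn {a b : ℝ} (ha : 0 ≤ a) (h : 7 * b ^ 3 ≤ 4) : MonotoneOn GLJ (Set.Icc a b) := by
  refine monotoneOn_of_deriv_nonneg (convex_Icc a b) (fun x _ => (hasDerivAt_GLJ x).continuousAt.continuousWithinAt)
    (fun x _ => (hasDerivAt_GLJ x).differentiableAt.differentiableWithinAt) ?_
  intro x hx
  rw [interior_Icc] at hx
  rw [(hasDerivAt_GLJ x).deriv]
  have hxpos : 0 ≤ x := ha.trans hx.1.le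
  have h3 : x ^ 3 ≤ b ^ 3 := pow_le_pow_left₀ hxpos hx.2.le 3
  have e : 4 * x ^ 3 - 7 * x ^ 6 = x ^ 3 * (4 - 7 * x ^ 3) := by ring
  rw [e]
  have : 0 ≤ x ^ 3 := by positivity
  have : 0 ≤ 4 - 7 * x ^ 3 := by linarith
  positivity

/-- `G` is antitone on `[a, b]` once `7a³ ≥ 4` (`a ≥ 0`). [folklore] -/
theorem GLJ_antitoneOn {a b : ℝ} (ha : 0 ≤ a) (h : 4 ≤ 7 * a ^ 3) : AntitoneOn GLJ (Set.Icc a b) := by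
  refine antitoneOn_of_deriv_nonpos (convex_Icc a b) (fun x _ => (hasDerivAt_GLJ x).continuousAt.continuousWithinAt)
    (fun x _ => (hasDerivAt_GLJ x).differentiableAt.differentiableWithinAt) ?_
  intro x hx
  rw [interior_Icc] at hx
  rw [(hasDerivAt_GLJ x).deriv]
  have hxpos : 0 ≤ x := ha.trans hx.1.le
  have h3 : a ^ 3 ≤ x ^ 3 := pow_le_pow_left₀ ha hx.1.le 3
  have e : 4 * x ^ 3 - 7 * x ^ 6 = -(x ^ 3 * (7 * x ^ 3 - 4)) := by ring
  rw [e, neg_nonpos]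
  have : 0 ≤ x ^ 3 := by positivity
  have : 0 ≤ 7 * x ^ 3 - 4 := by linarith
  positivity

/-- ★ UNIMODAL (minimum) ⟹ on any interval the MAXIMUM of `F` sits at an end point. [folklore] -/
theorem FLJ_le_max {a b u : ℝ} (ha : 0 < a) (hau : a ≤ u) (hub : u ≤ b) : FLJ u ≤ max (FLJ a) (FLJ b) := by
  by_cases h : 5 ≤ 14 * u ^ 3
  · -- increasing on `[u, b]`
    have hm := FLJ_monotoneOn (a := u) (b := b) (ha.le.trans hau) h
    exact (hm (Set.left_mem_Icc.2 hub) (Set.right_mem_Icc.2 hub) hub).trans (le_max_right _ _)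
  · have h' : 14 * u ^ 3 ≤ 5 := (not_le.mp h).le
    have hm := FLJ_antitoneOn (a := a) (b := u) ha.le h'
    exact (hm (Set.left_mem_Icc.2 hau) (Set.right_mem_Icc.2 hau) hau).trans (le_max_left _ _)

/-- ★ UNIMODAL (maximum) ⟹ on any interval the MINIMUM of `G` sits at an end point. [folklore] -/
theorem min_le_GLJ {a b u : ℝ} (ha : 0 < a) (hau : a ≤ u) (hub : u ≤ b) : min (GLJ a) (GLJ b) ≤ GLJ u := by
  by_cases h : 7 * u ^ 3 ≤ 4
  · -- increasing on `[a, u]`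
    have hm := GLJ_monotoneOn (a := a) (b := u) ha.le h
    exact (min_le_left _ _).trans (hm (Set.left_mem_Icc.2 hau) (Set.right_mem_Icc.2 hau) hau)
  · have h' : 4 ≤ 7 * u ^ 3 := (not_le.mp h).le
    have hm := GLJ_antitoneOn (a := u) (b := b) (ha.le.trans hau) h'
    exact (min_le_right _ _).trans (hm (Set.left_mem_Icc.2 hub) (Set.right_mem_Icc.2 hub) hub)

/-! ## §2. Scaled thresholds and thin intervals -/

/-- `thin k` is the point `k/SC`. [formal bookkeeping] -/
theorem mem_thin (k : ℤ) : FI.mem ((k : ℝ) / SC) (thin k) := FI.mem_ofScaled k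

/-- Upper threshold: `x ≤ qc n d` ⟹ `x ≤ n·SC/d` over `ℝ`. [arithmetic] -/
theorem le_of_le_qc {x : ℤ} {n d : ℕ} (hd : 0 < d) (h : x ≤ qc n d) : (x : ℝ) ≤ (n : ℝ) * SC / d := by
  have hd' : (0 : ℤ) < d := by exact_mod_cast hd
  have h1 : (n : ℤ) * (SC : ℤ) / d * d ≤ (n : ℤ) * (SC : ℤ) := Int.ediv_mul_le _ hd'.ne'
  have h2 : x * d ≤ (n : ℤ) * (SC : ℤ) := (mul_le_mul_of_nonneg_right h hd'.le).trans h1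
  have hdR : (0 : ℝ) < d := by exact_mod_cast hd
  rw [le_div_iff₀ hdR]
  exact_mod_cast h2

/-- Lower threshold: `qc n d ≤ x` ⟹ `n·SC/d − 1 < x` over `ℝ`. [arithmetic] -/
theorem lt_of_qc_le {x : ℤ} {n d : ℕ} (hd : 0 < d) (h : qc n d ≤ x) : (n : ℝ) * SC / d - 1 < x := by
  have hd' : (0 : ℤ) < d := by exact_mod_cast hd
  have h1 : (n : ℤ) * (SC : ℤ) < ((n : ℤ) * (SC : ℤ) / d + 1) * d := Int.lt_ediv_add_one_mul_self _ hd'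
  have h2 : (n : ℤ) * (SC : ℤ) < (x + 1) * d := h1.trans_le (mul_le_mul_of_nonneg_right (by unfold qc at h; omega) hd'.le)
  have hdR : (0 : ℝ) < d := by exact_mod_cast hd
  have h3 : ((n : ℝ) * SC) < ((x : ℝ) + 1) * d := by exact_mod_cast h2
  rw [sub_lt_iff_lt_add, div_lt_iff₀ hdR]
  linarith

/-! ## §3. ★ Soundness of the endpoint hulls -/

/-- The real end points of `Q` bracket every member. [formal bookkeeping] -/
theorem endpoints_of_mem {q : ℝ} {Q : FI} (hq : FI.mem q Q) : (Q.lo : ℝ) / SC ≤ q ∧ q ≤ (Q.hi : ℝ) / SC := by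
  obtain ⟨h1, h2⟩ := hq
  exact ⟨by rw [div_le_iff₀ SC_pos]; exact h1, by rw [le_div_iff₀ SC_pos]; exact h2⟩

/-- `14(q⁻¹)⁸ − 8(q⁻¹)⁵ = F(q⁻¹)`. [arithmetic] -/
theorem FLJ_eq (q : ℝ) : 14 * (q⁻¹) ^ 8 - 8 * (q⁻¹) ^ 5 = FLJ q⁻¹ := rfl

/-- `(q⁻¹)⁴ − (q⁻¹)⁷ = G(q⁻¹)`. [arithmetic] -/
theorem GLJ_eq (q : ℝ) : (q⁻¹) ^ 4 - (q⁻¹) ^ 7 = GLJ q⁻¹ := rfl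

/-- ★ `alphaLJHull` encloses `α_LJ = 14q⁻⁸ − 8q⁻⁵` on the whole interval (`Q.lo > 0`). [folklore] -/
theorem mem_alphaLJHull {q : ℝ} {Q A : FI} (hpos : 0 < Q.lo) (hq : FI.mem q Q) (h : alphaLJHull Q = some A) :
    FI.mem (14 * (q⁻¹) ^ 8 - 8 * (q⁻¹) ^ 5) A := by
  unfold alphaLJHull at h
  cases h1 : alphaLJFI (thin Q.lo) with
  | none => rw [h1] at h; exact absurd h (by simp)
  | some a1 =>
  cases h2 : alphaLJFI (thin Q.hi) with
  | none => rw [h1, h2] at h; exact absurd h (by simp)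
  | some a2 =>
  cases hn : alphaLJFI Q with
  | none => rw [h1, h2, hn] at h; exact absurd h (by simp)
  | some an =>
  rw [h1, h2, hn] at h
  simp only [Option.some.injEq] at h
  subst h
  -- real end points
  set q1 : ℝ := (Q.lo : ℝ) / SC with hq1
  set q2 : ℝ := (Q.hi : ℝ) / SC with hq2
  obtain ⟨hlo, hhi⟩ := endpoints_of_mem hq
  have hq1pos : 0 < q1 := div_pos (by exact_mod_cast hpos) SC_pos
  have hqpos : 0 < q := hq1pos.trans_le hlo
  have hq2pos : 0 < q2 := hqpos.trans_le hhi
  have m1 : FI.mem (FLJ q1⁻¹) a1 := by rw [← FLJ_eq]; exact mem_alphaLJFI (mem_thin Q.lo) h1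
  have m2 : FI.mem (FLJ q2⁻¹) a2 := by rw [← FLJ_eq]; exact mem_alphaLJFI (mem_thin Q.hi) h2
  have mn : FI.mem (FLJ q⁻¹) an := by rw [← FLJ_eq]; exact mem_alphaLJFI hq hn
  -- `u = q⁻¹ ∈ [q2⁻¹, q1⁻¹]`
  have hu1 : q⁻¹ ≤ q1⁻¹ := by rw [inv_le_inv₀ hqpos hq1pos]; exact hlo
  have hu2 : q2⁻¹ ≤ q⁻¹ := by rw [inv_le_inv₀ hq2pos hqpos]; exact hhi
  rw [FLJ_eq]
  constructor
  · -- lower end point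
    show ((if Q.hi ≤ qc 140 100 then a2.lo else if qc 142 100 ≤ Q.lo then a1.lo else an.lo : ℤ) : ℝ) ≤ FLJ q⁻¹ * SC
    split_ifs with hA hB
    · -- decreasing in `q`: `F` monotone on `[q2⁻¹, q⁻¹]` since `14 (q2⁻¹)³ ≥ 5` (`q2 ≤ 7/5`)
      have hq2le : q2 ≤ 7 / 5 := by
        have := le_of_le_qc (n := 140) (d := 100) (by norm_num) hA
        rw [hq2, div_le_iff₀ SC_pos]; linarith
      have hkey : 5 ≤ 14 * q2⁻¹ ^ 3 := by
        rw [inv_pow, le_mul_inv_iff₀ (by positivity)]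
        nlinarith [hq2pos, hq2le, mul_pos hq2pos hq2pos]
      have hm := FLJ_monotoneOn (a := q2⁻¹) (b := q⁻¹) (inv_pos.2 hq2pos).le hkey
      have := hm (Set.left_mem_Icc.2 hu2) (Set.right_mem_Icc.2 hu2) hu2
      exact m2.1.trans (mul_le_mul_of_nonneg_right this SC_pos.le)
    · -- increasing in `q`: `F` antitone on `[q⁻¹, q1⁻¹]` since `14 (q1⁻¹)³ ≤ 5` (`q1 > 71/50 − 1/SC ≥ 141/100`)
      have hq1ge : (141 : ℝ) / 100 ≤ q1 := by
        have := lt_of_qc_le (n := 142) (d := 100) (by norm_num) hB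
        rw [hq1, le_div_iff₀ SC_pos]
        have hS : (28147497671 : ℝ) ≤ SC := by norm_num [SC]
        push_cast at this
        linarith
      have hkey : 14 * q1⁻¹ ^ 3 ≤ 5 := by
        rw [inv_pow, mul_inv_le_iff₀ (by positivity)]
        nlinarith [hq1pos, hq1ge, mul_pos hq1pos hq1pos]
      have hm := FLJ_antitoneOn (a := q⁻¹) (b := q1⁻¹) (inv_pos.2 hqpos).le hkey
      have := hm (Set.left_mem_Icc.2 hu1) (Set.right_mem_Icc.2 hu1) hu1
      exact m1.1.trans (mul_le_mul_of_nonneg_right this SC_pos.le)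
    · exact mn.1
  · -- upper end point: unimodal ⟹ end points (or the naive hull)
    show FLJ q⁻¹ * SC ≤ ((if Q.lo < qc 142 100 ∧ qc 160 100 < Q.hi then an.hi else max a1.hi a2.hi : ℤ) : ℝ)
    split_ifs with hC
    · exact mn.2
    · have key := FLJ_le_max (a := q2⁻¹) (b := q1⁻¹) (inv_pos.2 hq2pos) hu2 hu1
      push_cast
      rcases le_max_iff.1 key with hk | hk
      · exact le_max_of_le_right ((mul_le_mul_of_nonneg_right hk SC_pos.le).trans m2.2)
      · exact le_max_of_le_left ((mul_le_mul_of_nonneg_right hk SC_pos.le).trans m1.2)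

/-- ★ `betaLJHull` encloses `β_LJ = q⁻⁴ − q⁻⁷` on the whole interval (`Q.lo > 0`). [folklore] -/
theorem mem_betaLJHull {q : ℝ} {Q B : FI} (hpos : 0 < Q.lo) (hq : FI.mem q Q) (h : betaLJHull Q = some B) :
    FI.mem ((q⁻¹) ^ 4 - (q⁻¹) ^ 7) B := by
  unfold betaLJHull at h
  cases h1 : phiFI (thin Q.lo) with
  | none => rw [h1] at h; exact absurd h (by simp)
  | some b1 =>
  cases h2 : phiFI (thin Q.hi) with
  | none => rw [h1, h2] at h; exact absurd h (by simp)
  | some b2 =>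
  cases hn : phiFI Q with
  | none => rw [h1, h2, hn] at h; exact absurd h (by simp)
  | some bn =>
  rw [h1, h2, hn] at h
  simp only [Option.some.injEq] at h
  subst h
  set q1 : ℝ := (Q.lo : ℝ) / SC with hq1
  set q2 : ℝ := (Q.hi : ℝ) / SC with hq2
  obtain ⟨hlo, hhi⟩ := endpoints_of_mem hq
  have hq1pos : 0 < q1 := div_pos (by exact_mod_cast hpos) SC_pos
  have hqpos : 0 < q := hq1pos.trans_le hlo
  have hq2pos : 0 < q2 := hqpos.trans_le hhi
  have m1 : FI.mem (GLJ q1⁻¹) b1 := by rw [← GLJ_eq]; exact mem_phiFI (mem_thin Q.lo) h1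
  have m2 : FI.mem (GLJ q2⁻¹) b2 := by rw [← GLJ_eq]; exact mem_phiFI (mem_thin Q.hi) h2
  have mn : FI.mem (GLJ q⁻¹) bn := by rw [← GLJ_eq]; exact mem_phiFI hq hn
  have hu1 : q⁻¹ ≤ q1⁻¹ := by rw [inv_le_inv₀ hqpos hq1pos]; exact hlo
  have hu2 : q2⁻¹ ≤ q⁻¹ := by rw [inv_le_inv₀ hq2pos hqpos]; exact hhi
  rw [GLJ_eq]
  constructor
  · -- minimum at an end point, always
    show ((if Q.hi ≤ qc 140 100 ∨ qc 122 100 ≤ Q.lo then min b1.lo b2.lo else bn.lo : ℤ) : ℝ) ≤ GLJ q⁻¹ * SC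
    split_ifs with hA
    · have key := min_le_GLJ (a := q2⁻¹) (b := q1⁻¹) (inv_pos.2 hq2pos) hu2 hu1
      push_cast
      rcases min_le_iff.1 key with hk | hk
      · exact min_le_of_right_le (m2.1.trans (mul_le_mul_of_nonneg_right hk SC_pos.le))
      · exact min_le_of_left_le (m1.1.trans (mul_le_mul_of_nonneg_right hk SC_pos.le))
    · exact mn.1
  · show GLJ q⁻¹ * SC ≤ ((if Q.hi ≤ qc 119 100 then b2.hi else if qc 122 100 ≤ Q.lo then b1.hi else bn.hi : ℤ) : ℝ)
    split_ifs with hA hB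
    · -- increasing in `q`: `G` antitone on `[q2⁻¹, q⁻¹]` since `7 (q2⁻¹)³ ≥ 4` (`q2 ≤ 119/100`)
      have hq2le : q2 ≤ 119 / 100 := by
        have := le_of_le_qc (n := 119) (d := 100) (by norm_num) hA
        rw [hq2, div_le_iff₀ SC_pos]; linarith
      have hkey : 4 ≤ 7 * q2⁻¹ ^ 3 := by
        rw [inv_pow, le_mul_inv_iff₀ (by positivity)]
        nlinarith [hq2pos, hq2le, mul_pos hq2pos hq2pos]
      have hm := GLJ_antitoneOn (a := q2⁻¹) (b := q⁻¹) (inv_pos.2 hq2pos).le hkey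
      have := hm (Set.left_mem_Icc.2 hu2) (Set.right_mem_Icc.2 hu2) hu2
      exact (mul_le_mul_of_nonneg_right this SC_pos.le).trans m2.2
    · -- decreasing in `q`: `G` monotone on `[q⁻¹, q1⁻¹]` since `7 (q1⁻¹)³ ≤ 4` (`q1 ≥ 121/100`)
      have hq1ge : (121 : ℝ) / 100 ≤ q1 := by
        have := lt_of_qc_le (n := 122) (d := 100) (by norm_num) hB
        rw [hq1, le_div_iff₀ SC_pos]
        have hS : (28147497671 : ℝ) ≤ SC := by norm_num [SC]
        push_cast at this
        linarith
      have hkey : 7 * q1⁻¹ ^ 3 ≤ 4 := by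
        rw [inv_pow, mul_inv_le_iff₀ (by positivity)]
        nlinarith [hq1pos, hq1ge, mul_pos hq1pos hq1pos]
      have hm := GLJ_monotoneOn (a := q⁻¹) (b := q1⁻¹) (inv_pos.2 hqpos).le hkey
      have := hm (Set.left_mem_Icc.2 hu1) (Set.right_mem_Icc.2 hu1) hu1
      exact (mul_le_mul_of_nonneg_right this SC_pos.le).trans m1.2
    · exact mn.2

end Summit.AtomisticToContinuum.Crystallization.Theorems.FrustratedLawDichotomyStrainedPatchHomValueT2Kit
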